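import Summits.CriticalPhenomena.CardyFormulaZ2.Theses.CardyQContinuation
import Literature.Probability.LatticeModels.RandomClusterConditionalDomination
import Literature.Probability.LatticeModels.FKIsingAnnulusCrossingProofs

/-!
# Crux `IsingJetsConformal`, stub `stub_loopSymmetricLimit_rcMeasure_mono_domain_wired`:
# the wired random-cluster measure is monotone in the domain and in the wired set
# (route `CardyQContinuation`, item stmt-CriticalPhenomena-5560, bridge lemma B1)

The `n = 0` bridge of the crux squeezes the FK-Ising crossing probability of the tree's
discretisation `Ω_δ` between Chelkak–Smirnov discrete quadrilaterals: an outer hull with a LARGER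
edge set and LARGER wired arcs has a LARGER probability of every increasing event (in particular of
the crossing event). In the tree's one-wired-set formalism (`rcMeasure G p q B`, the random-cluster
measure of the finite graph `G` with the vertex set `B` wired, `RandomCluster.lean`) this is the
chain of two proved comparison inequalities of the `Literature` library:

* monotonicity in the domain for a fixed wired set
  (`rcMeasure_fromEdgeSet_real_le`, Grimmett 2006, Thm. (3.1)(a) with Lemma (4.14)): for
  `U ⊆ E(G)` and increasing `A`, `φ^B_{⟨U⟩,p,q}(A) ≤ φ^B_{G,p,q}({ω | ω ∩ U ∈ A})`, valid as soon
  as the event "all edges off `U` closed" is non-null — which holds for `p < 1`, the empty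
  configuration having mass `(1 - p)^{|E(G)|} q^{k_B(∅)} / Z > 0`
  (`rcMeasure_real_offRegionClosed_pos_of_lt_one` below);
* monotonicity in the wired set for a fixed domain
  (`rcMeasure_real_mono_wired_of_isUpperSet`, Duminil-Copin–Smirnov 2012, Thm. 3.1; Grimmett 2006,
  Lemma (4.14)(b)): for `B ⊆ B'` and increasing `A'`, `φ^B_{G,p,q}(A') ≤ φ^{B'}_{G,p,q}(A')`,
  applied to the increasing event `A' = {ω | ω ∩ U ∈ A}`.

References: G. Grimmett, *The Random-Cluster Model*, Springer (2006), Thm. (3.1)(a), Lemma (4.14);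
H. Duminil-Copin, S. Smirnov, *Conformal invariance of lattice models*, Clay Math. Proc. 15 (2012),
Thm. 3.1; D. Chelkak, S. Smirnov, Invent. Math. 189 (2012), §1.2.
-/

namespace Summit.CriticalPhenomena.CardyFormulaZ2.Theorems.CardyQContinuation

open MeasureTheory SimpleGraph
open Literature.Probability.LatticeModels
open Literature.Probability.Percolation

noncomputable section

namespace RcMeasureMonoDomainWired

/-- **"All edges of `S` closed" is non-null for `p < 1`**: the empty configuration lies in the
event `{ω | ω ∩ S = ∅}` and has positive mass `(1 - p)^{|E(G)|} q^{k_B(∅)} / Z` under the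
random-cluster measure `φ^B_{G,p,q}`, `0 ≤ p < 1`, `q > 0` (Grimmett 2006, §1.2, eq. (1.2)).
[cite: Grimmett2006, §1.2 eq. (1.2)] -/
theorem rcMeasure_real_offRegionClosed_pos_of_lt_one {V : Type*} [Fintype V] [DecidableEq V]
    (G : SimpleGraph V) [DecidableRel G.Adj] {p q : ℝ} (hp : p ∈ Set.Icc (0 : ℝ) 1)
    (hp1 : p < 1) (hq : 0 < q) (B : Set V) (S : Set (Sym2 V)) :
    0 < (rcMeasure G p q B).real {ω | ω ∩ S = ∅} := by
  classical
  have hZ := rcPartitionFunction_pos G hp hq B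
  have hw : 0 < rcWeight G p q B ∅ := by
    simp only [rcWeight, Finset.card_empty, pow_zero, one_mul, Finset.sdiff_empty]
    exact mul_pos (pow_pos (sub_pos.2 hp1) _) (pow_pos hq _)
  have hmem : (↑(∅ : Finset (Sym2 V)) : BondConfig V) ∈ {ω : BondConfig V | ω ∩ S = ∅} := by
    simp
  rw [rcMeasure_real_apply G hp hq B]
  refine lt_of_lt_of_le (div_pos hw hZ) ?_
  rw [← Finset.sum_erase_add _ _ (Finset.empty_mem_powerset _), if_pos hmem]
  refine le_add_of_nonneg_left (Finset.sum_nonneg fun ω _ ↦ ?_)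
  split_ifs
  · exact div_nonneg (rcWeight_nonneg G hp hq.le B ω) hZ.le
  · exact le_rfl

end RcMeasureMonoDomainWired

open RcMeasureMonoDomainWired

/-- **Stub `stub_loopSymmetricLimit_rcMeasure_mono_domain_wired`** of the skeleton of the crux
`IsingJetsConformal` (stmt-CriticalPhenomena-5560, bridge lemma B1): for `0 ≤ p < 1`, `q ≥ 1`, an
edge set `U ⊆ E(G)`, wired sets `B ⊆ B'` and an increasing event `A`, the random-cluster measure of
the spanning graph `⟨U⟩` wired on `B` is dominated on `A` by the measure of `G` wired on `B'`, read
on the `U`-part of the configuration: `φ^B_{⟨U⟩,p,q}(A) ≤ φ^{B'}_{G,p,q}({ω | ω ∩ U ∈ A})`.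
Chain `rcMeasure_fromEdgeSet_real_le` (domain monotonicity; its non-nullity hypothesis from
`p < 1`) with `rcMeasure_real_mono_wired_of_isUpperSet` (wired-set monotonicity) on the increasing
event `{ω | ω ∩ U ∈ A}`. (Grimmett 2006, Thm. (3.1)(a), Lemma (4.14); Duminil-Copin–Smirnov 2012,
Thm. 3.1.) [cite: Grimmett2006, Lemma (4.14)] -/
theorem stub_loopSymmetricLimit_rcMeasure_mono_domain_wired : (∀ (V : Type) [Fintype V] [DecidableEq V] (G : SimpleGraph V) [DecidableRel G.Adj] (p q : ℝ), p ∈ Set.Icc (0:ℝ) 1 → p < 1 → 1 ≤ q → ∀ (U : Finset (Sym2 V)), U ⊆ G.edgeFinset → ∀ (B B' : Set V), B ⊆ B' → ∀ (A : Set (Literature.Probability.Percolation.BondConfig V)), IsUpperSet A → (Literature.Probability.LatticeModels.rcMeasure (SimpleGraph.fromEdgeSet (↑U : Set (Sym2 V))) p q B).real A ≤ (Literature.Probability.LatticeModels.rcMeasure G p q B').real {ω | ω ∩ ↑U ∈ A}) := by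
  intro V _ _ G _ p q hp hp1 hq U hU B B' hBB' A hA
  have hq0 : 0 < q := one_pos.trans_le hq
  have h0 : 0 < (rcMeasure G p q B).real {ω | ω ∩ (↑U : Set (Sym2 V))ᶜ = ∅} :=
    rcMeasure_real_offRegionClosed_pos_of_lt_one G hp hp1 hq0 B _
  have hA' : IsUpperSet {ω : BondConfig V | ω ∩ ↑U ∈ A} := fun ω₁ ω₂ h h₁ ↦
    hA (Set.inter_subset_inter_left _ h) h₁
  exact (rcMeasure_fromEdgeSet_real_le G hp hq B U hU h0 hA).trans
    (rcMeasure_real_mono_wired_of_isUpperSet G hp hq hBB' hA')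

end

end Summit.CriticalPhenomena.CardyFormulaZ2.Theorems.CardyQContinuation
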